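import Literature.NumberTheory.EllipticCurves.ModFiveCongruenceHesseFamily
import Literature.NumberTheory.Automorphic.CDTTheorem712
import HarnessLib

/-!
# stub-ideation k2 · GENERATION 16 — `stub_switch` (crux `FreyModularity`, stmt-ABC-11340)
# Typed MODULE-BOUNDARY statements of the reshaped landing (statements only; each `sorry` = one
# landing unit whose proof text already exists kernel-checked in the crux dir, see the plan §2).

M1 `hesse5_syzygy` · M2a Klein forms (`klein_syzygy`) · M2b `table_chainCertified` (g13's interface
VERBATIM) · M3 `thm132_restricted_of_chain` ▸ F1♮ · M4 `CDT_three_five_switch_of_thm132_restricted`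
(patched road) · M5 `CDT_three_five_switch_holds` (no own sorry) · L7 the stub VERBATIM (no own sorry).
-/

set_option linter.style.longLine false
set_option linter.dupNamespace false

namespace Summit.ABC.ABC.Cruxes.FreyModularity.StubSwitchK2g16

open Literature.NumberTheory.EllipticCurves Literature.NumberTheory.EllipticCurves.HesseFamilyFive
open Literature.NumberTheory.Automorphic Literature.NumberTheory.Automorphic.BCDT
open Literature.NumberTheory.GaloisRepresentations

/-! ## M1 `Literature/NumberTheory/EllipticCurves/ModFiveCongruenceHesseSyzygy.lean` -/

/-- **M1** Hesse's syzygy for the direct family, `n = 5`, both variables [Fisher2012Hessian, (8.1), §8].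
Proof text: k2-g12 `hesse_syzygy₂` (one-shot `field_simp; ring`, 124 s) or k3-g14 `hesse5_syzygy`
(eleven light steps, 477 s).  Serves BOTH consumers: g13 `hesse_syzygy_LM` (l, m) and the road's
`hesse_syzygy_F` (l, 1). -/
theorem hesse5_syzygy {F : Type*} [Field F] [CharZero F] (c₄ c₆ l m : F) :
    C4 c₄ c₆ l m ^ 3 - C6 c₄ c₆ l m ^ 2 = (c₄ ^ 3 - c₆ ^ 2) * D c₄ c₆ l m ^ 5 := by
  sorry

/-! ## M2a `…/KleinIcosahedralForms.lean` (g13 §0 verbatim) -/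

section Klein
variable {R : Type*} [CommRing R]

/-- Klein's icosahedral forms (g13 §0 verbatim). -/
def kD (a b : R) : R := a ^ 11 * b - 11 * a ^ 6 * b ^ 6 - a * b ^ 11
/-- Klein's `c₄`-form. -/
def kC4 (a b : R) : R :=
  a ^ 20 + 228 * a ^ 15 * b ^ 5 + 494 * a ^ 10 * b ^ 10 - 228 * a ^ 5 * b ^ 15 + b ^ 20
/-- Klein's `c₆`-form. -/
def kC6 (a b : R) : R :=
  -a ^ 30 + 522 * a ^ 25 * b ^ 5 + 10005 * a ^ 20 * b ^ 10 + 10005 * a ^ 10 * b ^ 20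
    - 522 * a ^ 5 * b ^ 25 - b ^ 30

/-- **M2a** boundary sample: Klein's syzygy (PROVED g13 l.62, `simp only [kD, kC4, kC6]; ring`). -/
theorem klein_syzygy (a b : R) : kC4 a b ^ 3 - kC6 a b ^ 2 = 1728 * kD a b ^ 5 := by
  sorry

end Klein

/-! ## M2b `…/KleinFiveTorsionTable.lean` — g13 §2 interface VERBATIM + k3-g14 Table A §1,§2,§4–§6 -/

structure SectionTable where
  X : ZMod 5 × ZMod 5 → ∀ (R : Type) [CommRing R], R → R → R → R
  Y : ZMod 5 × ZMod 5 → ∀ (R : Type) [CommRing R], R → R → R → R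
  map_X : ∀ (x : ZMod 5 × ZMod 5) (R S : Type) [CommRing R] [CommRing S] (φ : R →+* S)
    (z a b : R), φ (X x R z a b) = X x S (φ z) (φ a) (φ b)
  map_Y : ∀ (x : ZMod 5 × ZMod 5) (R S : Type) [CommRing R] [CommRing S] (φ : R →+* S)
    (z a b : R), φ (Y x R z a b) = Y x S (φ z) (φ a) (φ b)

/-- The two generators of the frame. -/
def gen : Fin 2 → ZMod 5 × ZMod 5 := ![(1, 0), (0, 1)]

/-- Chord law, denominators cleared. -/
def ChordRel {R : Type*} [CommRing R] (x₁ y₁ x₂ y₂ x₃ y₃ : R) : Prop :=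
  (x₃ + x₁ + x₂) * (x₁ - x₂) ^ 2 = (y₁ - y₂) ^ 2 ∧ (y₃ + y₁) * (x₁ - x₂) = (y₁ - y₂) * (x₁ - x₃)

/-- Tangent law, denominators cleared. -/
def TangentRel {R : Type*} [CommRing R] (A x₁ y₁ x₂ y₂ : R) : Prop :=
  (x₂ + 2 * x₁) * (2 * y₁) ^ 2 = (3 * x₁ ^ 2 + A) ^ 2 ∧
    (y₂ + y₁) * (2 * y₁) = (3 * x₁ ^ 2 + A) * (x₁ - x₂)

/-- g13's CHAIN certificates (verbatim). -/
structure SectionTable.ChainCertified (T : SectionTable) : Prop where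
  sign_X : ∀ (x : ZMod 5 × ZMod 5) (R : Type) [CommRing R] (z a b : R),
    T.X (-x) R z a b = T.X x R z a b
  sign_Y : ∀ (x : ZMod 5 × ZMod 5) (R : Type) [CommRing R] (z a b : R),
    T.Y (-x) R z a b = -T.Y x R z a b
  onCurve : ∀ (F : Type) [Field F] [CharZero F] (z a b : F), z ^ 4 + z ^ 3 + z ^ 2 + z + 1 = 0 →
    ∀ x : ZMod 5 × ZMod 5, x ≠ 0 →
      T.Y x F z a b ^ 2 =
        T.X x F z a b ^ 3 - 27 * 5 ^ 4 * kC4 a b * T.X x F z a b - 54 * 5 ^ 6 * kC6 a b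
  tangent : ∀ (F : Type) [Field F] [CharZero F] (z a b : F), z ^ 4 + z ^ 3 + z ^ 2 + z + 1 = 0 →
    ∀ i : Fin 2,
      TangentRel (-(27 * 5 ^ 4) * kC4 a b) (T.X (gen i) F z a b) (T.Y (gen i) F z a b)
        (T.X (gen i + gen i) F z a b) (T.Y (gen i + gen i) F z a b)
  triple : ∀ (F : Type) [Field F] [CharZero F] (z a b : F), z ^ 4 + z ^ 3 + z ^ 2 + z + 1 = 0 →
    ∀ i : Fin 2,
      ChordRel (T.X (gen i + gen i) F z a b) (T.Y (gen i + gen i) F z a b)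
        (T.X (gen i) F z a b) (T.Y (gen i) F z a b)
        (T.X (gen i + gen i + gen i) F z a b) (T.Y (gen i + gen i + gen i) F z a b)
  chord : ∀ (F : Type) [Field F] [CharZero F] (z a b : F), z ^ 4 + z ^ 3 + z ^ 2 + z + 1 = 0 →
    ∀ j k : ZMod 5, j ≠ 0 → k ≠ 0 →
      ChordRel (T.X (j, 0) F z a b) (T.Y (j, 0) F z a b) (T.X (0, k) F z a b) (T.Y (0, k) F z a b)
        (T.X (j, k) F z a b) (T.Y (j, k) F z a b)
  ndgX_gen : ∀ (F : Type) [Field F] [CharZero F] (z a b : F), z ^ 4 + z ^ 3 + z ^ 2 + z + 1 = 0 →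
    kD a b ≠ 0 → ∀ i : Fin 2, T.X (gen i + gen i) F z a b ≠ T.X (gen i) F z a b
  ndgX : ∀ (F : Type) [Field F] [CharZero F] (z a b : F), z ^ 4 + z ^ 3 + z ^ 2 + z + 1 = 0 →
    kD a b ≠ 0 → ∀ j k : ZMod 5, j ≠ 0 → k ≠ 0 → T.X (j, 0) F z a b ≠ T.X (0, k) F z a b
  ndgY : ∀ (F : Type) [Field F] [CharZero F] (z a b : F), z ^ 4 + z ^ 3 + z ^ 2 + z + 1 = 0 →
    kD a b ≠ 0 → ∀ i : Fin 2, T.Y (gen i) F z a b ≠ 0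

/-- **M2b** the certified chain table (PROVED: k3-g14 `…3g14_Table.lean`, rc 0, 0 sorry, 251 s). -/
theorem table_chainCertified : ∃ T : SectionTable, T.ChainCertified := by
  sorry

/-! ## M3 `…/KleinFiveTorsionFrame.lean` — g13 §1,§3–§7 ▸ F1♮ -/

/-- **F1♮** = Fisher Thm 13.2 (i), `n = 5`, restricted to `c₆ ≠ 0` (g13 l.1221 verbatim). -/
def thm132_restricted : Prop :=
  ∀ (E E' : WeierstrassCurve ℚ) [E.IsElliptic] [E'.IsElliptic] (c₄ c₆ l m : ℚ), c₆ ≠ 0 →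
    E = ⟨0, 0, 0, -27 * c₄, -54 * c₆⟩ →
    E' = ⟨0, 0, 0, -27 * C4 c₄ c₆ l m, -54 * C6 c₄ c₆ l m⟩ → Congr E' E

/-- F1♮ ≤ F1 (weaken-and-bootstrap: the named Literature fact dominates the restricted form; PROVED). -/
theorem thm132_restricted_of_thm132 (h : thm132_geomTorsionFive_of_hesseFamily) :
    thm132_restricted := by
  intro E E' _ _ c₄ c₆ l m _ hE hE'
  exact h E E' c₄ c₆ l m hE hE'

/-- **M3** (PROVED: g13 `thm132_restricted_of_chain`, kernel-checked inside k3-g14 B/D). -/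
theorem thm132_restricted_of_chain (hT : ∃ T : SectionTable, T.ChainCertified) :
    thm132_restricted := by
  sorry

/-- **M3** closing decl of the module. -/
theorem thm132_restricted_holds : thm132_restricted :=
  thm132_restricted_of_chain table_chainCertified

/-! ## M4 `Literature/NumberTheory/Automorphic/CDTThreeFiveSwitchOfHesse.lean` — the road, 3-site patch -/

/-- **M4** (PROVED: k3-g11 road with `hF : thm132_restricted`, kernel-checked inside k3-g14 D, 1208 s). -/
theorem CDT_three_five_switch_of_thm132_restricted (hF : thm132_restricted) :
    CDT_three_five_switch := by
  sorry

/-! ## M5 + L7: no own `sorry` — the verbatim stub type accepts the term -/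

/-- **M5** `…/CDTThreeFiveSwitchHolds.lean` (type = the registered fact BY NAME ⇒ `fact-discharged`). -/
theorem CDT_three_five_switch_holds : CDT_three_five_switch :=
  CDT_three_five_switch_of_thm132_restricted thm132_restricted_holds

/-- **L7** (PROVER, `Summits/ABC/ABC/Theorems/…`): the registered stub VERBATIM, one term. -/
theorem stub_switch :
    ∀ (W : WeierstrassCurve ℚ) [W.IsElliptic], ¬ 27 ∣ W.conductorNorm ℤ →
      (∀ ρ₃ : ModPGaloisRep ℚ (ZMod 3) 2, W.IsTorsionGaloisRep 3 ρ₃ →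
        ¬ ρ₃.IsAbsIrreducibleOverSqrt (-3)) →
      ∀ (ρ : ModPGaloisRep ℚ (ZMod 5) 2), W.IsTorsionGaloisRep 5 ρ → ρ.IsAbsIrreducibleOverSqrt 5 →
      ∃ (W' : WeierstrassCurve ℚ) (_ : W'.IsElliptic), W'.IsTorsionGaloisRep 5 ρ ∧
        ∃ ρ₃' : ModPGaloisRep ℚ (ZMod 3) 2, W'.IsTorsionGaloisRep 3 ρ₃' ∧
          ρ₃'.IsAbsIrreducibleOverSqrt (-3) :=
  CDT_three_five_switch_holds

/-- Sanity: the weak form (conditional on the NAMED fact F1) is available the moment M4 lands. -/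
theorem stub_switch_of_thm132 (hF : thm132_geomTorsionFive_of_hesseFamily) : CDT_three_five_switch :=
  CDT_three_five_switch_of_thm132_restricted (thm132_restricted_of_thm132 hF)

end Summit.ABC.ABC.Cruxes.FreyModularity.StubSwitchK2g16
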